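import Literature.Combinatorics.Additive.StevensDeZeeuwIncidence
import Mathlib.Algebra.Group.Pointwise.Finset.Basic
import Mathlib.Tactic

/-!
# Popular differences of a set with few products, via point–line incidences

Topic `Literature/Combinatorics/Additive`. The standard incidence encoding behind sum–product
estimates over arbitrary fields (Elekes; Roche-Newton–Rudnev–Shkredov; Stevens–de Zeeuw 2017 §1):
for `A ⊂ 𝔽 ∖ {0}` and `d ≠ 0`, every representation `d = u − v` (`u, v ∈ A`) and every pair
`(a, a') ∈ A × A` give an incidence of the point `(a u, a' v) ∈ (AA) × (AA)` with the line
`y = (a'/a) x − a' d`; the `|A|²` lines are distinct. Hence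

* `card_sub_rep_mul_le_incidences` — `r_{A−A}(d) · |A|² ≤ I((AA) × (AA), 𝓛_d)` (fully proved);
* `card_lines_eq` — `|𝓛_d| = |A|²` (fully proved);
* `popular_difference_le_of_sdz` — CONDITIONAL on the named fact `stevensDeZeeuw_thm4`
  (Stevens–de Zeeuw, BLMS 2017, Thm 4): `r_{A−A}(d) · |A|² ≤ C (|AA|^{5/4} |A|^{3/2} + |A|²)`
  whenever `|AA| ≤ |A|²` and (in characteristic `p > 0`) `|AA| · |A|² ≤ c₀ p²`.

Lines are coded as in `StevensDeZeeuwIncidence`: `Sum.inl (m, c)` is `y = m x + c`.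
Consumer: the spread-set energy bound of the DLOG band (crux `DlogGraphFlat`, `Summits/QuantumAdvantage`).
-/

namespace Literature.Combinatorics.Additive

open Finset
open scoped Pointwise

variable {F : Type*} [Field F] [DecidableEq F]

omit [DecidableEq F] in
/-- The line through the dilated difference pairs: `(a, a') ↦ {y = (a'/a) x − a' d}`. [cite: StevensDeZeeuw2017, §1] -/
theorem lineIncident_dilate (a a' u v d : F) (ha : a ≠ 0) (huv : u - v = d) :
    LineIncident (a * u, a' * v) (Sum.inl (a' / a, -(a' * d)) : (F × F) ⊕ F) := by
  show a' * v = a' / a * (a * u) + -(a' * d)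
  rw [div_mul_eq_mul_div, mul_comm a u, ← mul_assoc, mul_div_assoc, div_self ha, mul_one, ← huv]
  ring

/-- The `|A|²` lines `y = (a'/a) x − a' d`, `(a, a') ∈ A × A`, are pairwise distinct when
`0 ∉ A` and `d ≠ 0`. [cite: StevensDeZeeuw2017, §1] -/
theorem card_lines_eq (A : Finset F) (hA0 : (0 : F) ∉ A) (d : F) (hd : d ≠ 0) :
    ((A ×ˢ A).image fun a : F × F => (Sum.inl (a.2 / a.1, -(a.2 * d)) : (F × F) ⊕ F)).card =
      A.card * A.card := by
  rw [← Finset.card_product]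
  refine Finset.card_image_of_injOn ?_
  intro x hx x' hx' h
  rw [Finset.mem_coe, Finset.mem_product] at hx hx'
  have hx1 : x.1 ≠ 0 := fun e => hA0 (e ▸ hx.1)
  have hx1' : x'.1 ≠ 0 := fun e => hA0 (e ▸ hx'.1)
  have hx2 : x.2 ≠ 0 := fun e => hA0 (e ▸ hx.2)
  simp only [Sum.inl.injEq, Prod.mk.injEq, neg_inj] at h
  obtain ⟨h1, h2⟩ := h
  have e2 : x.2 = x'.2 := mul_right_cancel₀ hd h2
  rw [e2] at h1
  have hx2' : x'.2 ≠ 0 := e2 ▸ hx2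
  have e1 : x.1 = x'.1 := by
    rw [div_eq_div_iff hx1 hx1'] at h1
    exact (mul_left_cancel₀ hx2' h1).symm
  exact Prod.ext e1 e2

/-- **Incidence encoding of popular differences**: for `0 ∉ A` and `d ≠ 0`,
`r_{A−A}(d) · |A|² ≤ I((AA) × (AA), 𝓛_d)`. [cite: StevensDeZeeuw2017, §1] -/
theorem card_sub_rep_mul_le_incidences (A : Finset F) (hA0 : (0 : F) ∉ A) (d : F) (hd : d ≠ 0) :
    ((A ×ˢ A).filter fun x : F × F => x.1 - x.2 = d).card * (A.card * A.card) ≤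
      ((((A * A) ×ˢ (A * A)) ×ˢ
          ((A ×ˢ A).image fun a : F × F => (Sum.inl (a.2 / a.1, -(a.2 * d)) : (F × F) ⊕ F))).filter
        fun q => LineIncident q.1 q.2).card := by
  rw [← Finset.card_product A A, ← Finset.card_product]
  refine Finset.card_le_card_of_injOn
    (fun z : (F × F) × (F × F) =>
      (((z.2.1 * z.1.1, z.2.2 * z.1.2) : F × F),
        (Sum.inl (z.2.2 / z.2.1, -(z.2.2 * d)) : (F × F) ⊕ F))) ?_ ?_
  · intro z hz
    rw [Finset.mem_coe, Finset.mem_product, Finset.mem_filter, Finset.mem_product,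
      Finset.mem_product] at hz
    obtain ⟨⟨⟨hu, hv⟩, huv⟩, ha, ha'⟩ := hz
    have ha0 : z.2.1 ≠ 0 := fun e => hA0 (e ▸ ha)
    rw [Finset.mem_coe, Finset.mem_filter, Finset.mem_product, Finset.mem_product]
    refine ⟨⟨⟨Finset.mul_mem_mul ha hu, Finset.mul_mem_mul ha' hv⟩,
      Finset.mem_image.mpr ⟨(z.2.1, z.2.2), Finset.mem_product.mpr ⟨ha, ha'⟩, rfl⟩⟩, ?_⟩
    exact lineIncident_dilate _ _ _ _ _ ha0 huv
  · intro z hz z' hz' h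
    rw [Finset.mem_coe, Finset.mem_product, Finset.mem_filter, Finset.mem_product,
      Finset.mem_product] at hz hz'
    have ha0 : z.2.1 ≠ 0 := fun e => hA0 (e ▸ hz.2.1)
    have ha0' : z'.2.1 ≠ 0 := fun e => hA0 (e ▸ hz'.2.1)
    have hb0 : z.2.2 ≠ 0 := fun e => hA0 (e ▸ hz.2.2)
    simp only [Prod.mk.injEq, Sum.inl.injEq, neg_inj] at h
    obtain ⟨⟨h1, h2⟩, h3, h4⟩ := h
    have eb : z.2.2 = z'.2.2 := mul_right_cancel₀ hd h4
    have hb0' : z'.2.2 ≠ 0 := eb ▸ hb0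
    have ea : z.2.1 = z'.2.1 := by
      rw [eb, div_eq_div_iff ha0 ha0'] at h3
      exact (mul_left_cancel₀ hb0' h3).symm
    rw [ea] at h1
    rw [eb] at h2
    have eu : z.1.1 = z'.1.1 := mul_left_cancel₀ ha0' h1
    have ev : z.1.2 = z'.1.2 := mul_left_cancel₀ hb0' h2
    exact Prod.ext (Prod.ext eu ev) (Prod.ext ea eb)

/-- **Popular differences of a set with few products** (conditional on Stevens–de Zeeuw, Thm 4):
for `0 ∉ A ⊂ 𝔽`, `|AA| ≤ |A|²`, and `|AA|·|A|² ≤ c₀ p²` in characteristic `p > 0`, every non-zero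
`d` has `r_{A−A}(d) · |A|² ≤ C (|AA|^{5/4} |A|^{3/2} + |A|²)`. [cite: StevensDeZeeuw2017, Theorem 4 + §1] -/
theorem popular_difference_le_of_sdz (hsdz : stevensDeZeeuw_thm4) (c₀ : ℝ) (hc₀ : 0 < c₀) :
    ∃ C : ℝ, 0 < C ∧ ∀ (F : Type) [Field F] [DecidableEq F] (A : Finset F), (0 : F) ∉ A →
      ((A * A).card : ℝ) ≤ (A.card : ℝ) ^ 2 →
      (ringChar F = 0 ∨ ((A * A).card : ℝ) * ((A.card : ℝ) * A.card) ≤ c₀ * (ringChar F : ℝ) ^ 2) →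
      ∀ d : F, d ≠ 0 →
      ((((A ×ˢ A).filter fun x : F × F => x.1 - x.2 = d).card : ℝ) * ((A.card : ℝ) * A.card) ≤
        C * (((A * A).card : ℝ) ^ (5 / 4 : ℝ) * (A.card : ℝ) ^ (3 / 2 : ℝ) + (A.card : ℝ) * A.card)) := by
  obtain ⟨C, hC, h⟩ := hsdz c₀ hc₀
  refine ⟨C, hC, ?_⟩
  intro F _ _ A hA0 hAA hchar d hd
  classical
  set L := (A ×ˢ A).image fun a : F × F => (Sum.inl (a.2 / a.1, -(a.2 * d)) : (F × F) ⊕ F) with hL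
  have hLcard : (L.card : ℝ) = (A.card : ℝ) * A.card := by
    rw [hL, card_lines_eq A hA0 d hd]; push_cast; ring
  have h1 := card_sub_rep_mul_le_incidences A hA0 d hd
  have h1R : (((A ×ˢ A).filter fun x : F × F => x.1 - x.2 = d).card : ℝ) * ((A.card : ℝ) * A.card) ≤
      ((((A * A) ×ˢ (A * A)) ×ˢ L).filter fun q => LineIncident q.1 q.2).card := by
    rw [hL]; exact_mod_cast h1
  have hcond1 : ((A * A).card : ℝ) * ((A * A).card : ℝ) ^ 2 ≤ (L.card : ℝ) ^ 3 := by
    rw [hLcard]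
    have h0 : (0 : ℝ) ≤ (A * A).card := Nat.cast_nonneg _
    calc ((A * A).card : ℝ) * ((A * A).card : ℝ) ^ 2 = ((A * A).card : ℝ) ^ 3 := by ring
      _ ≤ ((A.card : ℝ) ^ 2) ^ 3 := pow_le_pow_left₀ h0 hAA 3
      _ = ((A.card : ℝ) * A.card) ^ 3 := by ring
  have hcond2 : ringChar F = 0 ∨ ((A * A).card : ℝ) * (L.card : ℝ) ≤ c₀ * (ringChar F : ℝ) ^ 2 := by
    rw [hLcard]; exact hchar
  have h2 := h F (A * A) (A * A) L le_rfl hcond1 hcond2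
  refine h1R.trans (h2.trans (le_of_eq ?_))
  rw [hLcard]
  have hA : (0 : ℝ) ≤ A.card := Nat.cast_nonneg _
  have hAA0 : (0 : ℝ) ≤ (A * A).card := Nat.cast_nonneg _
  have e0 : (A.card : ℝ) * A.card = (A.card : ℝ) ^ (2 : ℝ) := by rw [Real.rpow_two]; ring
  have e1 : ((A.card : ℝ) * A.card) ^ (3 / 4 : ℝ) = (A.card : ℝ) ^ (3 / 2 : ℝ) := by
    rw [e0, ← Real.rpow_mul hA]
    norm_num
  have e2 : ((A * A).card : ℝ) ^ (3 / 4 : ℝ) * ((A * A).card : ℝ) ^ (1 / 2 : ℝ) =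
      ((A * A).card : ℝ) ^ (5 / 4 : ℝ) := by
    rw [← Real.rpow_add' hAA0 (by norm_num)]; norm_num
  rw [e1, ← e2]

end Literature.Combinatorics.Additive
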